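import Literature.NumberTheory.GelbartRogawski1991.LocalUnitarySplitPlaceLagrangian
import Literature.NumberTheory.Automorphic.UnitaryGroupFinAdelicCenterLocal
import Literature.NumberTheory.Automorphic.AdicCompletionDegreeOnePlaceEquiv
import Literature.RepresentationTheory.HeisenbergGroup.SymplecticMatrixTransport
import Literature.NumberTheory.Automorphic.LocalPiSchwartzBruhatFourier
import Literature.NumberTheory.Automorphic.Liu2021.Def411WeilCarriersSurvivalSplit
import HarnessLib

/-!
# The local unitary group at a split place is a Darboux conjugate of the Siegel Levi subgroup

Topic `NumberTheory/GelbartRogawski1991`; namespace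
`Literature.NumberTheory.GelbartRogawski1991.UnitaryDualPair.LocalSplitting`. KERNEL mathematics only (three
plumbing definitions `splitSqrt`, `splitCoord`, `splitDarboux` and theorems; no named fact, no `axiom`, no `sorry`).
Sequel of `LocalUnitarySplitPlaceLagrangian.lean` (the idempotents `e_w`, `e_w̄` of `E ⊗_F F_v = E_w × E_w̄` at a
split place and the stable Lagrangians `ℓ_w = e_w 𝕎_v`, `ℓ_w̄ = e_w̄ 𝕎_v` of `ι_v(U(J)(F_v)) ⊆ Sp(𝕎_v)`), written
over the local splitting datum of `LocalUnitarySplittingDatum.lean` (`𝕎_v = F_vᴺ × F_vᴺ` with the form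
`alt (polar β_{𝕋_v})`, `𝕋_v = localGram T v`, `ι_v = iota … v : U(J)(F_v) →* Sp(𝕎_v)` for `J = T ⊗ 1`).

`E/F` is a quadratic extension of number fields with `c ∈ Gal(E/F)`, `δ ∈ E`, `c δ = -δ ≠ 0`, `δ² = d ∈ F`;
`v` is a finite place of `F`, `K = F_v`, and `w ∣ v` is SPLIT (`c w ≠ w`), so that `w̄ = c⁻¹ w ≠ w` and
`ι_w = toPlace v w : F_v ≃ E_w` (`e(w|v) = 1`).

## Main statements

* §1–§2 `splitIdem_mul_splitIdem_galInv`, `splitIdem_add_splitIdem_galInv`, `re_splitIdem`, `im_splitIdem_ne_zero`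
  — the idempotents: `e_w e_w̄ = 0`, `e_w + e_w̄ = 1`, `e_w = ½ + β δ` with `β ≠ 0`; `splitSqrt` — **the square root
  `δ_w := (2β)⁻¹ ∈ F_v` of `d` attached to `w`** (`splitSqrt_mul_self : δ_w² = d`, `delta_mul_splitIdem :
  δ e_w = δ_w e_w`, `splitSqrt_galInv : δ_w̄ = -δ_w`, `toPlace_splitSqrt : ι_w(δ_w) = δ`); `splitCoord` — the
  `w`-coordinate `a_w : E ⊗ F_v → F_v`, `a_w(s) = re s + δ_w im s` (`mul_splitIdem_eq : s e_w = a_w(s) e_w`,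
  `toPlace_splitCoord : ι_w(a_w(s)) = s_w`, `toPlace_surjective`);
* §3 `mem_splitLagrangian_iff` — **`ℓ_w = {(x, y) | x = δ_w y}`**; `splitLagrangian_sup_galInv : ℓ_w ⊔ ℓ_w̄ = ⊤`;
* §4 `splitDarboux` — **the integral Darboux element `γ_w ∈ Sp(𝕎_v)` of a split place**,
  `γ_w (x, y) = (x + δ_w y, -(2δ_w)⁻¹ x + ½ y)`, with `splitDarboux_apply_of_mem : γ_w (δ_w y, y) = (2δ_w y, 0)`
  (`γ_w ℓ_w = X_v ⊕ 0`), `splitDarboux_apply_of_mem_galInv : γ_w (-δ_w y, y) = (0, y)` (`γ_w ℓ_w̄ = 0 ⊕ Y_v`) and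
  `splitDarboux_mapsTo` — `γ_w` preserves `𝒪_vᴺ × 𝒪_vᴺ` when `2, δ_w ∈ 𝒪_v^×`;
* §5 `LocalSp.eq_of_eqOn_of_mapsTo` — rigidity: two elements of `Sp(𝕎_v)` that agree on a subspace `L₁` and both
  stabilise an isotropic complement `L₂` (`L₁ ⊔ L₂ = ⊤`) are equal;
* §6 `iota_eq_conj_levi` — **`ι_v(κ) = γ_w⁻¹ m(a) γ_w`** for every `κ ∈ U(J)(F_v)` whose `w`-component is `ι_w(a)`,
  `a ∈ GL_N(F_v)`, where `m(a) = transportSp 𝕋_v (levi a)` is the Siegel Levi element of `a`;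
* §7 `iota_localCenter_eq` — the centre `E_v¹ ∋ z₀ ↦ z₀ · 1_N` acts as `γ_w⁻¹ m(a_w(ζ) · 1_N) γ_w`;
  `iota_localPiSplitEquiv_symm_map`, `exists_localInt_iota_eq` — under `U(J)(F_v) ≅ GL_N(E_w)`
  (`localPiSplitEquiv`) the element with `w`-component `ι_w(a)` acts as `γ_w⁻¹ m(a) γ_w`, and for `a ∈ GL_N(𝒪_v)`
  it lies in `U(J)(𝒪_v)`; `valued_toPlace_of_split`, `valued_splitCoord`, `valued_splitSqrt`,
  `eventually_forall_valued_splitSqrt_eq_one`, `eventually_valued_two_eq_one` — valuations at a split place and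
  the almost-everywhere unit conditions; `valued_entry_eq_exp_or_of_generates` — a generator `z₀` of `U(J₁)(F_v)`
  modulo `U(J₁)(𝒪_v)` has `w`-component of valuation `q_w^{∓1}`.
  Together with `RepresentationTheory/HeisenbergGroup/SchrodingerConjugateTorusSpherical.lean` (hypotheses `hγ`,
  `hM`, `hu` there are `splitDarboux_mapsTo`, `iota_localCenter_eq`, `exists_localInt_iota_eq` here) this is the
  local input of the split-place clause `(SPH)` of `FinLocalSplittings.exists_finset_mk_unitVec_ne_zero_of_sph`
  ([GelbartRogawski1991] §3.2: at a split `v` the dual pair `U(1) × U(N)` is `GL_1 × GL_N` inside a Siegel Levi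
  up to conjugation). Written for the stage-1 cell `pub-hodgecm`; nothing here is a claim of the manuscripts
  adjudicated there.

## References

* C. Mœglin, M.-F. Vignéras, J.-L. Waldspurger, *Correspondances de Howe sur un corps p-adique*, LNM 1291 (1987),
  Chap. 2 II.10, III.1 [MoeglinVignerasWaldspurger1987].
* S. Gelbart, J. Rogawski, *L-functions and Fourier–Jacobi coefficients for the unitary group U(3)*, Invent. Math.
  105 (1991), §3.2, p. 457 [GelbartRogawski1991].
* J. W. S. Cassels, A. Fröhlich (eds.), *Algebraic Number Theory* (1967), Ch. I §5, Ch. II §10, §16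
  [CasselsFrohlichANT1967].
* V. Platonov, A. Rapinchuk, *Algebraic Groups and Number Theory* (1994), §5.1 [PlatonovRapinchuk1994].
* C. P. Mok, *Endoscopic classification of representations of quasi-split unitary groups*, Mem. AMS 235 (2015), §1
  [Mok2014].
-/

set_option autoImplicit false

noncomputable section

open NumberField IsDedekindDomain Matrix ValuativeRel Filter
open Literature.RepresentationTheory.HeisenbergGroup Literature.RepresentationTheory.HeisenbergGroup.SymplecticMatrix
open Literature.NumberTheory.Automorphic Literature.NumberTheory.Automorphic.UnitaryGroup
open Literature.NumberTheory.Automorphic.UnitaryGroup.QuadraticCoordinates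

namespace Literature.NumberTheory.GelbartRogawski1991.UnitaryDualPair.LocalSplitting

variable (F : Type) [Field F] [NumberField F] (E : Type) [Field E] [NumberField E] [Algebra F E]
  [Algebra.IsQuadraticExtension F E] (c : E ≃ₐ[F] E) (N : ℕ)
  {δ : E} (hcδ : c δ = -δ) (hδ : δ ≠ 0) {d : F} (hd : δ * δ = algebraMap F E d)
  (T : Matrix (Fin N) (Fin N) F)
  {J : Matrix (Fin N) (Fin N) E} (hJ : J = T.map (algebraMap F E))
  (v : HeightOneSpectrum (𝓞 F))

local notation "K" => HeightOneSpectrum.adicCompletion F v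
local notation "S" => LocalRing E v
set_option quotPrecheck false in
local notation "W" => ((Fin N → HeightOneSpectrum.adicCompletion F v) × (Fin N → HeightOneSpectrum.adicCompletion F v))
set_option quotPrecheck false in
local notation "Ψv" => (quadraticLocalEquiv E v c hcδ hδ).toLinearEquiv.toAddEquiv

/-! ## §1 The split idempotents `e_w`, `e_w̄` -/

section Idem

omit [NumberField F] [Algebra.IsQuadraticExtension F E] in
/-- `e_w(w') = if w' = w then 1 else 0`. [folklore] -/
private theorem splitIdem_apply' (w w' : PlacesOver E v) :
    splitIdem F E v w w' = open scoped Classical in if w' = w then 1 else 0 := rfl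

omit [NumberField F] [Algebra.IsQuadraticExtension F E] in
/-- `e_w(w) = 1`. [folklore] -/
private theorem splitIdem_self (w : PlacesOver E v) : splitIdem F E v w w = 1 := by
  rw [splitIdem_apply', if_pos rfl]

omit [NumberField F] [Algebra.IsQuadraticExtension F E] in
/-- `e_w(w') = 0` for `w' ≠ w`. [folklore] -/
private theorem splitIdem_ne {w w' : PlacesOver E v} (h : w' ≠ w) : splitIdem F E v w w' = 0 := by
  rw [splitIdem_apply', if_neg h]

omit [NumberField F] [Algebra.IsQuadraticExtension F E] in
/-- `e_w² = e_w`. [cite: CasselsFrohlichANT1967, Ch. II §10] -/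
theorem splitIdem_mul_splitIdem (w : PlacesOver E v) : splitIdem F E v w * splitIdem F E v w = splitIdem F E v w := by
  funext w'; by_cases h : w' = w
  · subst h; rw [Pi.mul_apply, splitIdem_self, mul_one]
  · rw [Pi.mul_apply, splitIdem_ne F E v h, mul_zero]

omit [NumberField F] [NumberField E] [Algebra.IsQuadraticExtension F E] in
/-- the places above a split `v` are `w` and `w̄ = galInv c w ≠ w`. [folklore] -/
private theorem hc_of_hw {w : PlacesOver E v} (hw : c • w.1 ≠ w.1) : c ≠ 1 := by
  rintro rfl; exact hw (one_smul _ _)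

omit [Algebra.IsQuadraticExtension F E] in
/-- `e_w · e_w̄ = 0`. [cite: CasselsFrohlichANT1967, Ch. II §10] -/
theorem splitIdem_mul_splitIdem_galInv (w : PlacesOver E v) (hw : c • w.1 ≠ w.1) :
    splitIdem F E v w * splitIdem F E v (PlacesOver.galInv c w) = 0 := by
  funext w'
  rw [Pi.mul_apply, Pi.zero_apply]
  by_cases h : w' = w
  · subst h; rw [splitIdem_ne F E v (PlacesOver.galInv_ne c w' hw).symm, mul_zero]
  · rw [splitIdem_ne F E v h, zero_mul]

/-- `e_w + e_w̄ = 1` (exactly two places above a split `v`). [cite: CasselsFrohlichANT1967, Ch. II §10] -/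
theorem splitIdem_add_splitIdem_galInv (w : PlacesOver E v) (hw : c • w.1 ≠ w.1) :
    splitIdem F E v w + splitIdem F E v (PlacesOver.galInv c w) = 1 := by
  funext w'
  rw [Pi.add_apply, Pi.one_apply]
  rcases PlacesOver.eq_or_eq_galInv c (hc_of_hw F E c v hw) w w' with rfl | rfl
  · rw [splitIdem_self, splitIdem_ne F E v (PlacesOver.galInv_ne c w' hw).symm, add_zero]
  · rw [splitIdem_self, splitIdem_ne F E v (PlacesOver.galInv_ne c w hw), zero_add]

/-- `e_w̄ = 1 - e_w`. [cite: CasselsFrohlichANT1967, Ch. II §10] -/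
theorem splitIdem_galInv_eq (w : PlacesOver E v) (hw : c • w.1 ≠ w.1) :
    splitIdem F E v (PlacesOver.galInv c w) = 1 - splitIdem F E v w := by
  rw [← splitIdem_add_splitIdem_galInv F E c v w hw, add_sub_cancel_left]

omit [NumberField F] [Algebra.IsQuadraticExtension F E] in
/-- `e_w ≠ 0`. [cite: CasselsFrohlichANT1967, Ch. II §10] -/
theorem splitIdem_ne_zero (w : PlacesOver E v) : splitIdem F E v w ≠ 0 := fun h => by
  have := congrFun h w
  rw [splitIdem_self, Pi.zero_apply] at this
  exact one_ne_zero this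

omit [Algebra.IsQuadraticExtension F E] in
/-- `e_w ≠ 1` at a split place. [cite: CasselsFrohlichANT1967, Ch. II §10] -/
theorem splitIdem_ne_one (w : PlacesOver E v) (hw : c • w.1 ≠ w.1) : splitIdem F E v w ≠ 1 := fun h => by
  have := congrFun h (PlacesOver.galInv c w)
  rw [splitIdem_ne F E v (PlacesOver.galInv_ne c w hw), Pi.one_apply] at this
  exact zero_ne_one this

end Idem

/-! ## §2 The square root `δ_w ∈ F_v` of `d` attached to a split `w`, and the `w`-coordinate `E ⊗ F_v → F_v` -/

section Sqrt

/-- `(2 : F_v) ≠ 0`. [folklore] -/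
private theorem two_ne_zero' : (2 : K) ≠ 0 := two_ne_zero

include hd in
/-- the coordinates `(α, β)` of the idempotent `e_w = α + β δ` satisfy `α² + d β² = α` and `2 α β = β`. [folklore] -/
private theorem re_im_splitIdem (w : PlacesOver E v) :
    re Ψv (splitIdem F E v w) * re Ψv (splitIdem F E v w) +
        (d : K) * (im Ψv (splitIdem F E v w) * im Ψv (splitIdem F E v w)) = re Ψv (splitIdem F E v w) ∧
      re Ψv (splitIdem F E v w) * im Ψv (splitIdem F E v w) + im Ψv (splitIdem F E v w) * re Ψv (splitIdem F E v w) =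
        im Ψv (splitIdem F E v w) := by
  have h := isQuadraticCoordinates_local E v c hcδ hδ hd
  have h2 := splitIdem_mul_splitIdem F E v w
  constructor
  · have := h.re_mul (splitIdem F E v w) (splitIdem F E v w)
    rw [h2] at this; exact this.symm
  · have := h.im_mul (splitIdem F E v w) (splitIdem F E v w)
    rw [h2] at this; exact this.symm

include hd in
/-- `β = im e_w ≠ 0` at a split place (else `e_w = α ∈ F_v` with `α² = α`, so `e_w ∈ {0, 1}`).
[cite: CasselsFrohlichANT1967, Ch. II §10] -/
theorem im_splitIdem_ne_zero (w : PlacesOver E v) (hw : c • w.1 ≠ w.1) : im Ψv (splitIdem F E v w) ≠ 0 := by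
  intro h0
  have h := isQuadraticCoordinates_local E v c hcδ hδ hd
  obtain ⟨hre, -⟩ := re_im_splitIdem F E c hcδ hδ hd v w
  rw [h0, mul_zero, mul_zero, add_zero] at hre
  -- `e_w = ι(α)` with `α² = α`
  have he : splitIdem F E v w = toLocalRing E v (re Ψv (splitIdem F E v w)) := by
    conv_lhs => rw [← h.re_add_im (splitIdem F E v w), h0, map_zero, zero_mul, add_zero]
  rcases mul_eq_zero.1 (show re Ψv (splitIdem F E v w) * (re Ψv (splitIdem F E v w) - 1) = 0 by
    rw [mul_sub, mul_one, hre, sub_self]) with h1 | h1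
  · exact splitIdem_ne_zero F E v w (by rw [he, h1, map_zero])
  · exact splitIdem_ne_one F E c v w hw (by rw [he, sub_eq_zero.1 h1, map_one])

include hd in
/-- `α = re e_w = ½` at a split place. [cite: CasselsFrohlichANT1967, Ch. II §10] -/
theorem re_splitIdem (w : PlacesOver E v) (hw : c • w.1 ≠ w.1) : re Ψv (splitIdem F E v w) = 2⁻¹ := by
  obtain ⟨-, him⟩ := re_im_splitIdem F E c hcδ hδ hd v w
  have hβ := im_splitIdem_ne_zero F E c hcδ hδ hd v w hw
  have : (2 * re Ψv (splitIdem F E v w) - 1) * im Ψv (splitIdem F E v w) = 0 := by linear_combination him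
  rcases mul_eq_zero.1 this with h1 | h1
  · exact eq_inv_of_mul_eq_one_right (sub_eq_zero.1 h1)
  · exact absurd h1 hβ

/-- **`δ_w := (2 β)⁻¹ ∈ F_v`**, `β = im e_w`: the square root of `d` in `F_v` singled out by the split place `w`
(`δ e_w = δ_w e_w`). [folklore] -/
def splitSqrt (w : PlacesOver E v) : K := (2 * im Ψv (splitIdem F E v w))⁻¹

include hd in
/-- `4 d β² = 1`. [folklore] -/
private theorem d_mul_sq (w : PlacesOver E v) (hw : c • w.1 ≠ w.1) :
    (d : K) * ((2 * im Ψv (splitIdem F E v w)) * (2 * im Ψv (splitIdem F E v w))) = 1 := by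
  obtain ⟨hre, -⟩ := re_im_splitIdem F E c hcδ hδ hd v w
  rw [re_splitIdem F E c hcδ hδ hd v w hw] at hre
  have h22 : (2 : K) * 2⁻¹ = 1 := mul_inv_cancel₀ (two_ne_zero' F v)
  linear_combination (4 : K) * hre - ((2 : K) * 2⁻¹ - 1) * h22

include hd in
/-- `δ_w² = d`. [cite: CasselsFrohlichANT1967, Ch. II §10] -/
theorem splitSqrt_mul_self (w : PlacesOver E v) (hw : c • w.1 ≠ w.1) :
    splitSqrt F E c hcδ hδ v w * splitSqrt F E c hcδ hδ v w = (d : K) := by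
  rw [splitSqrt, ← mul_inv]
  exact inv_eq_of_mul_eq_one_left (d_mul_sq F E c hcδ hδ hd v w hw)

include hd in
/-- `δ_w ≠ 0`. [cite: CasselsFrohlichANT1967, Ch. II §10] -/
theorem splitSqrt_ne_zero (w : PlacesOver E v) (hw : c • w.1 ≠ w.1) : splitSqrt F E c hcδ hδ v w ≠ 0 :=
  inv_ne_zero (mul_ne_zero (two_ne_zero' F v) (im_splitIdem_ne_zero F E c hcδ hδ hd v w hw))

include hd in
/-- `2 β δ_w = 1`. [cite: CasselsFrohlichANT1967, Ch. II §10] -/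
theorem two_mul_im_mul_splitSqrt (w : PlacesOver E v) (hw : c • w.1 ≠ w.1) :
    2 * im Ψv (splitIdem F E v w) * splitSqrt F E c hcδ hδ v w = 1 :=
  mul_inv_cancel₀ (mul_ne_zero (two_ne_zero' F v) (im_splitIdem_ne_zero F E c hcδ hδ hd v w hw))

include hd in
/-- two elements of `E ⊗ F_v` with the same coordinates are equal. [folklore] -/
private theorem ext_re_im {x y : S} (h1 : re Ψv x = re Ψv y) (h2 : im Ψv x = im Ψv y) : x = y := by
  have h := isQuadraticCoordinates_local E v c hcδ hδ hd
  rw [← h.re_add_im x, ← h.re_add_im y, h1, h2]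

include hd in
/-- coordinates of `ι(a) e_w`: `(a/2, a β)`. [folklore] -/
private theorem re_im_toLocalRing_mul_splitIdem (w : PlacesOver E v) (hw : c • w.1 ≠ w.1) (a : K) :
    re Ψv (toLocalRing E v a * splitIdem F E v w) = a * 2⁻¹ ∧
      im Ψv (toLocalRing E v a * splitIdem F E v w) = a * im Ψv (splitIdem F E v w) := by
  have h := isQuadraticCoordinates_local E v c hcδ hδ hd
  exact ⟨by rw [h.re_map_mul, re_splitIdem F E c hcδ hδ hd v w hw], h.im_map_mul _ _⟩

include hd in
/-- **`δ e_w = δ_w e_w`**: `δ` acts on the factor `e_w (E ⊗ F_v)` through the scalar `δ_w ∈ F_v`.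
[cite: CasselsFrohlichANT1967, Ch. II §10] -/
theorem delta_mul_splitIdem (w : PlacesOver E v) (hw : c • w.1 ≠ w.1) :
    algebraMap E S δ * splitIdem F E v w = toLocalRing E v (splitSqrt F E c hcδ hδ v w) * splitIdem F E v w := by
  have h := isQuadraticCoordinates_local E v c hcδ hδ hd
  obtain ⟨hre', him'⟩ := re_im_toLocalRing_mul_splitIdem F E c hcδ hδ hd v w hw (splitSqrt F E c hcδ hδ v w)
  have hkey := d_mul_sq F E c hcδ hδ hd v w hw
  have hβ := im_splitIdem_ne_zero F E c hcδ hδ hd v w hw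
  refine ext_re_im F E c hcδ hδ hd v ?_ ?_
  · rw [hre', h.re_mul, h.re_delta, h.im_delta, zero_mul, one_mul, zero_add, splitSqrt, ← mul_inv]
    symm
    apply inv_eq_of_mul_eq_one_left
    linear_combination hkey
  · rw [him', h.im_mul, h.re_delta, h.im_delta, zero_mul, zero_add, one_mul, re_splitIdem F E c hcδ hδ hd v w hw,
      splitSqrt, mul_inv, mul_assoc, inv_mul_cancel₀ hβ, mul_one]

/-- **the `w`-coordinate `a_w : E ⊗ F_v → F_v`**, `a_w(s) = re s + δ_w im s` (`s e_w = ι(a_w s) e_w`). [folklore] -/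
def splitCoord (w : PlacesOver E v) (s : S) : K := re Ψv s + splitSqrt F E c hcδ hδ v w * im Ψv s

include hd in
/-- **`s e_w = ι(a_w s) e_w`**. [cite: CasselsFrohlichANT1967, Ch. II §10] -/
theorem mul_splitIdem_eq (w : PlacesOver E v) (hw : c • w.1 ≠ w.1) (s : S) :
    s * splitIdem F E v w = toLocalRing E v (splitCoord F E c hcδ hδ v w s) * splitIdem F E v w := by
  have h := isQuadraticCoordinates_local E v c hcδ hδ hd
  conv_lhs => rw [← h.re_add_im s]
  rw [splitCoord, add_mul, mul_assoc, delta_mul_splitIdem F E c hcδ hδ hd v w hw, ← mul_assoc, ← map_mul, ← add_mul,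
    ← map_add, mul_comm (im Ψv s)]

include hd in
/-- `ι_w(a_w s) = s_w`: the component at `w`. [cite: CasselsFrohlichANT1967, Ch. II §10] -/
theorem toPlace_splitCoord (w : PlacesOver E v) (hw : c • w.1 ≠ w.1) (s : S) :
    toPlace v w (splitCoord F E c hcδ hδ v w s) = s w := by
  have := congrFun (mul_splitIdem_eq F E c hcδ hδ hd v w hw s) w
  rw [Pi.mul_apply, Pi.mul_apply, splitIdem_self, mul_one, mul_one, toLocalRing_apply] at this
  exact this.symm

include hcδ hδ hd in
/-- hence `ι_w : F_v → E_w` is onto at a split place. [cite: CasselsFrohlichANT1967, Ch. II §10] -/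
theorem toPlace_surjective (w : PlacesOver E v) (hw : c • w.1 ≠ w.1) : Function.Surjective (toPlace (E := E) v w) := by
  classical
  exact fun x => ⟨splitCoord F E c hcδ hδ v w (Pi.single w x),
    by rw [toPlace_splitCoord F E c hcδ hδ hd v w hw, Pi.single_eq_same]⟩

include hd in
/-- `δ_{w̄} = -δ_w`. [cite: CasselsFrohlichANT1967, Ch. II §10] -/
theorem splitSqrt_galInv (w : PlacesOver E v) (hw : c • w.1 ≠ w.1) :
    splitSqrt F E c hcδ hδ v (PlacesOver.galInv c w) = -splitSqrt F E c hcδ hδ v w := by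
  have h := isQuadraticCoordinates_local E v c hcδ hδ hd
  rw [splitSqrt, splitSqrt, splitIdem_galInv_eq F E c v w hw, map_sub, h.im_one, zero_sub, mul_neg, inv_neg]

end Sqrt

/-! ## §3 The two stable Lagrangians of a split place in coordinates: `ℓ_w = {(δ_w y, y)}`, `ℓ_w̄ = {(-δ_w y, y)}` -/

section Lagr

variable {T}

/-- membership in `splitLagrangian` (definitional). [folklore] -/
private theorem mem_splitLagrangian (w : PlacesOver E v) (p : (Fin N → K) × (Fin N → K)) :
    p ∈ splitLagrangian F E c N hcδ hδ hd v w ↔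
      ∃ x : Fin N → S, splitIdem F E v w • x = x ∧ p = localReIm F E c N hcδ hδ v x := Iff.rfl

/-- `x ↦ ι(a) e_w` has coordinates `(a/2, a β)`; so `e_w x = x` iff `x = ι(2 δ_w im x) e_w`… in the form used
below: the element with coordinates `(δ_w b, b)` is `ι(2 δ_w b) e_w`. [folklore] -/
private theorem eq_toLocalRing_mul_splitIdem (hd : δ * δ = algebraMap F E d) (w : PlacesOver E v) (hw : c • w.1 ≠ w.1)
    (b : K) :
    (quadraticLocalEquiv E v c hcδ hδ).toLinearEquiv.toAddEquiv (splitSqrt F E c hcδ hδ v w * b, b) =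
      toLocalRing E v (2 * splitSqrt F E c hcδ hδ v w * b) * splitIdem F E v w := by
  obtain ⟨hre, him⟩ := re_im_toLocalRing_mul_splitIdem F E c hcδ hδ hd v w hw (2 * splitSqrt F E c hcδ hδ v w * b)
  have h1 := two_mul_im_mul_splitSqrt F E c hcδ hδ hd v w hw
  have h22 : (2 : K) * 2⁻¹ = 1 := mul_inv_cancel₀ (two_ne_zero' F v)
  refine ext_re_im F E c hcδ hδ hd v ?_ ?_
  · rw [re_apply, hre]
    linear_combination (-(splitSqrt F E c hcδ hδ v w * b)) * h22
  · rw [im_apply, him]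
    linear_combination (-b) * h1

/-- **`ℓ_w = {(x, y) : x = δ_w y}`**: the stable Lagrangian `reIm (e_w (E ⊗ F_v)ᴺ)` of a split place in the
coordinates `F_vᴺ ⊕ F_vᴺ δ` (and `ℓ_w̄ = {x = -δ_w y}` by `splitSqrt_galInv`).
[cite: MoeglinVignerasWaldspurger1987, Chap. 2 III.1] -/
theorem mem_splitLagrangian_iff (w : PlacesOver E v) (hw : c • w.1 ≠ w.1) (p : (Fin N → K) × (Fin N → K)) :
    p ∈ splitLagrangian F E c N hcδ hδ hd v w ↔ p.1 = splitSqrt F E c hcδ hδ v w • p.2 := by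
  have h1 := two_mul_im_mul_splitSqrt F E c hcδ hδ hd v w hw
  have h22 : (2 : K) * 2⁻¹ = 1 := mul_inv_cancel₀ (two_ne_zero' F v)
  rw [mem_splitLagrangian]
  constructor
  · rintro ⟨x, hx, rfl⟩
    funext i
    have hxi : x i * splitIdem F E v w = x i := by rw [mul_comm]; exact congrFun hx i
    obtain ⟨hre, him⟩ := re_im_toLocalRing_mul_splitIdem F E c hcδ hδ hd v w hw (splitCoord F E c hcδ hδ v w (x i))
    rw [← mul_splitIdem_eq F E c hcδ hδ hd v w hw, hxi] at hre him
    rw [Pi.smul_apply, smul_eq_mul, reIm_apply_fst, reIm_apply_snd, hre, him]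
    linear_combination (-(splitCoord F E c hcδ hδ v w (x i) * 2⁻¹)) * h1 +
      (splitCoord F E c hcδ hδ v w (x i) * im (quadraticLocalEquiv E v c hcδ hδ).toLinearEquiv.toAddEquiv
        (splitIdem F E v w) * splitSqrt F E c hcδ hδ v w) * h22
  · intro hp
    refine ⟨(localReIm F E c N hcδ hδ v).symm p, funext fun i => ?_,
      ((localReIm F E c N hcδ hδ v).apply_symm_apply p).symm⟩
    rw [Pi.smul_apply, smul_eq_mul, reIm_symm_apply, hp, Pi.smul_apply, smul_eq_mul,
      eq_toLocalRing_mul_splitIdem F E c hcδ hδ v hd w hw, mul_left_comm, splitIdem_mul_splitIdem]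

/-- **`ℓ_w + ℓ_w̄ = everything`** (`x = e_w x + e_w̄ x`). [cite: MoeglinVignerasWaldspurger1987, Chap. 2 III.1] -/
theorem splitLagrangian_sup_galInv (w : PlacesOver E v) (hw : c • w.1 ≠ w.1) :
    splitLagrangian F E c N hcδ hδ hd v w ⊔ splitLagrangian F E c N hcδ hδ hd v (PlacesOver.galInv c w) = ⊤ := by
  rw [eq_top_iff]
  intro p _
  obtain ⟨x, rfl⟩ : ∃ x, p = localReIm F E c N hcδ hδ v x := ⟨(localReIm F E c N hcδ hδ v).symm p,
    ((localReIm F E c N hcδ hδ v).apply_symm_apply p).symm⟩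
  have hx : x = splitIdem F E v w • x + splitIdem F E v (PlacesOver.galInv c w) • x := by
    rw [← add_smul, splitIdem_add_splitIdem_galInv F E c v w hw, one_smul]
  rw [hx, map_add]
  refine Submodule.add_mem_sup ⟨_, ?_, rfl⟩ ⟨_, ?_, rfl⟩
  · rw [smul_smul, splitIdem_mul_splitIdem]
  · rw [smul_smul, splitIdem_mul_splitIdem]

end Lagr

omit [Algebra.IsQuadraticExtension F E] in
/-- `w̄` is split too: `c • w̄ ≠ w̄`. [cite: CasselsFrohlichANT1967, Ch. II §10] -/
theorem smul_galInv_ne (w : PlacesOver E v) (hw : c • w.1 ≠ w.1) :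
    c • (PlacesOver.galInv c w).1 ≠ (PlacesOver.galInv c w).1 := by
  intro h
  apply hw
  change c • c⁻¹ • w.1 = c⁻¹ • w.1 at h
  rw [smul_inv_smul] at h
  conv_lhs => rw [h]
  rw [smul_inv_smul]

/-! ## §4 The integral Darboux element `γ_w ∈ Sp(𝕎_v)` with `γ_w ℓ_w = X_v ⊕ 0`, `γ_w ℓ_w̄ = 0 ⊕ Y_v` -/

section Darboux

/-- `⟨x, 𝕋_v y⟩ = ⟨y, 𝕋_v x⟩` (`T` symmetric). [cite: MoeglinVignerasWaldspurger1987, Chap. 2 III.1] -/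
theorem dotProduct_localGram_mulVec_comm (hT : T.IsSymm) (x y : Fin N → K) :
    x ⬝ᵥ (localGram F N T v *ᵥ y) = y ⬝ᵥ (localGram F N T v *ᵥ x) := by
  have hs : (localGram F N T v).IsSymm := hT.map _
  conv_rhs => rw [dotProduct_mulVec, ← mulVec_transpose, hs.eq, dotProduct_comm]

/-- the block-scalar automorphism `(x, y) ↦ (x + e y, -z x + u y)` of `F_vᴺ × F_vᴺ`. [folklore] -/
private def darbouxLin (e z u : K) : ((Fin N → K) × (Fin N → K)) →ₗ[K] ((Fin N → K) × (Fin N → K)) :=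
  LinearMap.prod (LinearMap.fst K _ _ + e • LinearMap.snd K _ _) ((-z) • LinearMap.fst K _ _ + u • LinearMap.snd K _ _)

/-- its inverse `(x, y) ↦ (u x - e y, z x + y)` (when `u + e z = 1`). [folklore] -/
private def darbouxInv (e z u : K) : ((Fin N → K) × (Fin N → K)) →ₗ[K] ((Fin N → K) × (Fin N → K)) :=
  LinearMap.prod (u • LinearMap.fst K _ _ - e • LinearMap.snd K _ _) (z • LinearMap.fst K _ _ + LinearMap.snd K _ _)

/-- pointwise formula of `darbouxLin`. [folklore] -/
private theorem darbouxLin_apply (e z u : K) (p : (Fin N → K) × (Fin N → K)) :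
    darbouxLin F N v e z u p = (p.1 + e • p.2, (-z) • p.1 + u • p.2) := rfl

/-- pointwise formula of `darbouxInv`. [folklore] -/
private theorem darbouxInv_apply (e z u : K) (p : (Fin N → K) × (Fin N → K)) :
    darbouxInv F N v e z u p = (u • p.1 - e • p.2, z • p.1 + p.2) := rfl

/-- `darbouxLin ∘ darbouxInv = id` when `u + e z = 1`. [folklore] -/
private theorem darbouxLin_comp_inv (e z u : K) (h : u + e * z = 1) :
    darbouxLin F N v e z u ∘ₗ darbouxInv F N v e z u = LinearMap.id := by
  refine LinearMap.ext fun p => Prod.ext (funext fun i => ?_) (funext fun i => ?_)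
  · simp only [LinearMap.comp_apply, darbouxLin_apply, darbouxInv_apply, LinearMap.id_apply, Pi.add_apply,
      Pi.sub_apply, Pi.smul_apply, smul_eq_mul]
    linear_combination (p.1 i) * h
  · simp only [LinearMap.comp_apply, darbouxLin_apply, darbouxInv_apply, LinearMap.id_apply, Pi.add_apply,
      Pi.sub_apply, Pi.smul_apply, smul_eq_mul]
    linear_combination (p.2 i) * h

/-- `darbouxInv ∘ darbouxLin = id` when `u + e z = 1`. [folklore] -/
private theorem darbouxInv_comp_lin (e z u : K) (h : u + e * z = 1) :
    darbouxInv F N v e z u ∘ₗ darbouxLin F N v e z u = LinearMap.id := by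
  refine LinearMap.ext fun p => Prod.ext (funext fun i => ?_) (funext fun i => ?_)
  · simp only [LinearMap.comp_apply, darbouxLin_apply, darbouxInv_apply, LinearMap.id_apply, Pi.add_apply,
      Pi.sub_apply, Pi.smul_apply, smul_eq_mul]
    linear_combination (p.1 i) * h
  · simp only [LinearMap.comp_apply, darbouxLin_apply, darbouxInv_apply, LinearMap.id_apply, Pi.add_apply,
      Pi.smul_apply, smul_eq_mul]
    linear_combination (p.2 i) * h

/-- the block-scalar automorphism as a linear equivalence. [folklore] -/
private def darbouxEquiv (e z u : K) (h : u + e * z = 1) :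
    ((Fin N → K) × (Fin N → K)) ≃ₗ[K] ((Fin N → K) × (Fin N → K)) :=
  LinearEquiv.ofLinear (darbouxLin F N v e z u) (darbouxInv F N v e z u) (darbouxLin_comp_inv F N v e z u h)
    (darbouxInv_comp_lin F N v e z u h)

/-- a block-scalar automorphism `(x, y) ↦ (x + e y, -z x + u y)` with `u + e z = 1` is symplectic for
`alt (polar β_{𝕋_v})`, `T` symmetric. [folklore] -/
private theorem darbouxEquiv_mem (hT : T.IsSymm) (e z u : K) (h : u + e * z = 1) :
    darbouxEquiv F N v e z u h ∈ LocalSp F N T v := by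
  rw [mem_symplecticGroup]
  intro p q
  have s1 := dotProduct_localGram_mulVec_comm F N T v hT (q.1) (p.1)
  have s2 := dotProduct_localGram_mulVec_comm F N T v hT (q.2) (p.2)
  have s3 := dotProduct_localGram_mulVec_comm F N T v hT (p.2) (q.1)
  have s4 := dotProduct_localGram_mulVec_comm F N T v hT (q.2) (p.1)
  show localPairing F N T v _ _ - localPairing F N T v _ _ = localPairing F N T v _ _ - localPairing F N T v _ _
  simp only [darbouxEquiv, LinearEquiv.ofLinear_apply, darbouxLin_apply, LinearMap.fst_apply, LinearMap.snd_apply,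
    Matrix.toLinearMap₂'_apply', mulVec_add, mulVec_smul, dotProduct_add, add_dotProduct, dotProduct_smul,
    smul_dotProduct, smul_eq_mul]
  linear_combination (-(-z)) * s1 + (-(e * u)) * s2 + (e * (-z)) * s3 + (-(e * (-z))) * s4 +
    ((p.1 ⬝ᵥ (localGram F N T v *ᵥ q.2) - q.1 ⬝ᵥ (localGram F N T v *ᵥ p.2))) * h

include hd in
/-- `2⁻¹ + δ_w (2 δ_w)⁻¹ = 1`. [folklore] -/
private theorem half_add (w : PlacesOver E v) (hw : c • w.1 ≠ w.1) :
    (2⁻¹ : K) + splitSqrt F E c hcδ hδ v w * (2 * splitSqrt F E c hcδ hδ v w)⁻¹ = 1 := by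
  have h2 := two_ne_zero' F v
  have hδ' := splitSqrt_ne_zero F E c hcδ hδ hd v w hw
  field_simp
  ring

/-- **the integral Darboux element of a split place** `γ_w ∈ Sp(𝕎_v)`:
`γ_w (x, y) = (x + δ_w y, -(2δ_w)⁻¹ x + ½ y)` — block-scalar, symplectic for `alt (polar β_{𝕋_v})`, carrying the
stable Lagrangians `ℓ_w`, `ℓ_w̄` of the split torus to the standard polarisation `X_v ⊕ 0`, `0 ⊕ Y_v`, and
integral (preserving `𝒪_vᴺ × 𝒪_vᴺ`) whenever `2` and `δ_w` are `v`-units (MVW's "on choisit une base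
symplectique adaptée à la décomposition `W = W_1 ⊕ W_2`", made explicit and integral).
[cite: MoeglinVignerasWaldspurger1987, Chap. 2 III.1; GelbartRogawski1991, §3.2 p. 457] -/
def splitDarboux (hT : T.IsSymm) (w : PlacesOver E v) (hw : c • w.1 ≠ w.1) : LocalSp F N T v :=
  ⟨darbouxEquiv F N v (splitSqrt F E c hcδ hδ v w) (2 * splitSqrt F E c hcδ hδ v w)⁻¹ 2⁻¹
      (half_add F E c hcδ hδ hd v w hw),
    darbouxEquiv_mem F N T v hT _ _ _ _⟩

/-- `γ_w (x, y) = (x + δ_w y, -(2δ_w)⁻¹ x + ½ y)`. [cite: MoeglinVignerasWaldspurger1987, Chap. 2 III.1] -/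
theorem coe_splitDarboux_apply (hT : T.IsSymm) (w : PlacesOver E v) (hw : c • w.1 ≠ w.1)
    (p : (Fin N → K) × (Fin N → K)) :
    ((splitDarboux F E c N hcδ hδ hd T v hT w hw : LocalSp F N T v) : _ ≃ₗ[K] _) p =
      (p.1 + splitSqrt F E c hcδ hδ v w • p.2,
        (-(2 * splitSqrt F E c hcδ hδ v w)⁻¹) • p.1 + (2⁻¹ : K) • p.2) := rfl

/-- `γ_w⁻¹ (x, y) = (½ x - δ_w y, (2δ_w)⁻¹ x + y)`. [cite: MoeglinVignerasWaldspurger1987, Chap. 2 III.1] -/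
theorem coe_splitDarboux_inv_apply (hT : T.IsSymm) (w : PlacesOver E v) (hw : c • w.1 ≠ w.1)
    (p : (Fin N → K) × (Fin N → K)) :
    (((splitDarboux F E c N hcδ hδ hd T v hT w hw)⁻¹ : LocalSp F N T v) : _ ≃ₗ[K] _) p =
      ((2⁻¹ : K) • p.1 - splitSqrt F E c hcδ hδ v w • p.2, (2 * splitSqrt F E c hcδ hδ v w)⁻¹ • p.1 + p.2) := rfl

/-- **`γ_w ℓ_w ⊆ X_v ⊕ 0`**, precisely `γ_w (δ_w y, y) = (2 δ_w y, 0)`.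
[cite: MoeglinVignerasWaldspurger1987, Chap. 2 III.1] -/
theorem splitDarboux_apply_of_mem (hT : T.IsSymm) (w : PlacesOver E v) (hw : c • w.1 ≠ w.1)
    {p : (Fin N → K) × (Fin N → K)} (hp : p ∈ splitLagrangian F E c N hcδ hδ hd v w) :
    ((splitDarboux F E c N hcδ hδ hd T v hT w hw : LocalSp F N T v) : _ ≃ₗ[K] _) p =
      ((2 * splitSqrt F E c hcδ hδ v w) • p.2, (0 : Fin N → K)) := by
  rw [mem_splitLagrangian_iff F E c N hcδ hδ hd v w hw] at hp
  have h22 : (2 : K) * 2⁻¹ = 1 := mul_inv_cancel₀ (two_ne_zero' F v)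
  have hz : 2 * splitSqrt F E c hcδ hδ v w * (2 * splitSqrt F E c hcδ hδ v w)⁻¹ = 1 :=
    mul_inv_cancel₀ (mul_ne_zero (two_ne_zero' F v) (splitSqrt_ne_zero F E c hcδ hδ hd v w hw))
  rw [coe_splitDarboux_apply, hp]
  refine Prod.ext (funext fun i => ?_) (funext fun i => ?_)
  · simp only [Pi.add_apply, Pi.smul_apply, smul_eq_mul]
    ring
  · simp only [Pi.add_apply, Pi.smul_apply, smul_eq_mul, Pi.zero_apply]
    linear_combination (splitSqrt F E c hcδ hδ v w * (2 * splitSqrt F E c hcδ hδ v w)⁻¹ * p.2 i) * h22 +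
      (-(2⁻¹ * p.2 i)) * hz

/-- **`γ_w ℓ_w̄ ⊆ 0 ⊕ Y_v`**, precisely `γ_w (-δ_w y, y) = (0, y)`.
[cite: MoeglinVignerasWaldspurger1987, Chap. 2 III.1] -/
theorem splitDarboux_apply_of_mem_galInv (hT : T.IsSymm) (w : PlacesOver E v) (hw : c • w.1 ≠ w.1)
    {p : (Fin N → K) × (Fin N → K)} (hp : p ∈ splitLagrangian F E c N hcδ hδ hd v (PlacesOver.galInv c w)) :
    ((splitDarboux F E c N hcδ hδ hd T v hT w hw : LocalSp F N T v) : _ ≃ₗ[K] _) p = ((0 : Fin N → K), p.2) := by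
  rw [mem_splitLagrangian_iff F E c N hcδ hδ hd v _ (smul_galInv_ne F E c v w hw),
    splitSqrt_galInv F E c hcδ hδ hd v w hw] at hp
  have h22 : (2 : K) * 2⁻¹ = 1 := mul_inv_cancel₀ (two_ne_zero' F v)
  have hz : 2 * splitSqrt F E c hcδ hδ v w * (2 * splitSqrt F E c hcδ hδ v w)⁻¹ = 1 :=
    mul_inv_cancel₀ (mul_ne_zero (two_ne_zero' F v) (splitSqrt_ne_zero F E c hcδ hδ hd v w hw))
  rw [coe_splitDarboux_apply, hp]
  refine Prod.ext (funext fun i => ?_) (funext fun i => ?_)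
  · simp only [Pi.add_apply, Pi.smul_apply, smul_eq_mul, Pi.zero_apply, neg_mul]
    ring
  · simp only [Pi.add_apply, Pi.smul_apply, smul_eq_mul, neg_mul, mul_neg, neg_neg]
    linear_combination ((1 - splitSqrt F E c hcδ hδ v w * (2 * splitSqrt F E c hcδ hδ v w)⁻¹) * p.2 i) * h22 +
      (2⁻¹ * p.2 i) * hz

/-- `γ_w⁻¹ (x, 0) = (½ x, (2δ_w)⁻¹ x) ∈ ℓ_w`. [cite: MoeglinVignerasWaldspurger1987, Chap. 2 III.1] -/
theorem splitDarboux_inv_apply_inl_mem (hT : T.IsSymm) (w : PlacesOver E v) (hw : c • w.1 ≠ w.1) (x : Fin N → K) :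
    (((splitDarboux F E c N hcδ hδ hd T v hT w hw)⁻¹ : LocalSp F N T v) : _ ≃ₗ[K] _) (x, (0 : Fin N → K)) ∈
      splitLagrangian F E c N hcδ hδ hd v w := by
  rw [mem_splitLagrangian_iff F E c N hcδ hδ hd v w hw, coe_splitDarboux_inv_apply, smul_zero, sub_zero, add_zero,
    smul_smul]
  have h2 := two_ne_zero' F v
  have hδ' := splitSqrt_ne_zero F E c hcδ hδ hd v w hw
  field_simp

/-- `γ_w⁻¹ (0, y) = (-δ_w y, y) ∈ ℓ_w̄`. [cite: MoeglinVignerasWaldspurger1987, Chap. 2 III.1] -/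
theorem splitDarboux_inv_apply_inr_mem (hT : T.IsSymm) (w : PlacesOver E v) (hw : c • w.1 ≠ w.1) (y : Fin N → K) :
    (((splitDarboux F E c N hcδ hδ hd T v hT w hw)⁻¹ : LocalSp F N T v) : _ ≃ₗ[K] _) ((0 : Fin N → K), y) ∈
      splitLagrangian F E c N hcδ hδ hd v (PlacesOver.galInv c w) := by
  rw [mem_splitLagrangian_iff F E c N hcδ hδ hd v _ (smul_galInv_ne F E c v w hw),
    splitSqrt_galInv F E c hcδ hδ hd v w hw, coe_splitDarboux_inv_apply, smul_zero, zero_sub, smul_zero, zero_add,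
    neg_smul]

/-- **integrality**: if `2` and `δ_w` are `v`-adic units then `γ_w (𝒪_vᴺ × 𝒪_vᴺ) ⊆ 𝒪_vᴺ × 𝒪_vᴺ` (the hypothesis
`hγ` of `SchrodingerConjugateTorusSpherical`). [cite: MoeglinVignerasWaldspurger1987, Chap. 2 II.10] -/
theorem splitDarboux_mapsTo (hT : T.IsSymm) (w : PlacesOver E v) (hw : c • w.1 ≠ w.1)
    (h2 : Valued.v (2 : K) = 1) (hδw : Valued.v (splitSqrt F E c hcδ hδ v w) = 1) :
    ∀ p ∈ (piPrimePowBall K (Fin N) 0) ×ˢ (piPrimePowBall K (Fin N) 0),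
      ((splitDarboux F E c N hcδ hδ hd T v hT w hw : LocalSp F N T v) : _ ≃ₗ[K] _) p ∈
        (piPrimePowBall K (Fin N) 0) ×ˢ (piPrimePowBall K (Fin N) 0) := by
  intro p hp
  simp only [Set.mem_prod, mem_piPrimePowBall_iff, Literature.NumberTheory.Automorphic.mem_primePowBall_zero_iff,
    HeightOneSpectrum.mem_adicCompletionIntegers] at hp ⊢
  rw [coe_splitDarboux_apply]
  refine ⟨fun i => ?_, fun i => ?_⟩
  · simp only [Pi.add_apply, Pi.smul_apply, smul_eq_mul]
    refine (Valued.v.map_add _ _).trans (max_le (hp.1 i) ?_)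
    rw [map_mul, hδw, one_mul]
    exact hp.2 i
  · simp only [Pi.add_apply, Pi.smul_apply, smul_eq_mul]
    refine (Valued.v.map_add _ _).trans (max_le ?_ ?_)
    · rw [map_mul, Valuation.map_neg, map_inv₀, map_mul, h2, hδw, one_mul, inv_one, one_mul]
      exact hp.1 i
    · rw [map_mul, map_inv₀, h2, inv_one, one_mul]
      exact hp.2 i

end Darboux

/-! ## §5 Rigidity: a symplectic map is determined by its restriction to `L₁` and the stability of a
complementary isotropic `L₂` -/

section Rigidity

/-- **rigidity**: if `g, h ∈ Sp(𝕎_v)` agree on `L₁`, both stabilise an isotropic subspace `L₂`, and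
`L₁ + L₂ = 𝕎_v`, then `g = h` (for `p ∈ L₂`, `g p - h p ∈ L₂` is orthogonal to `g L₁ = h L₁` by invariance of
the form and to `L₂ ⊇ g L₂` by isotropy, hence to everything).
[cite: MoeglinVignerasWaldspurger1987, Chap. 2 III.1] -/
theorem LocalSp.eq_of_eqOn_of_mapsTo (hTd : IsUnit T.det) {g h : LocalSp F N T v}
    {L₁ L₂ : Submodule K ((Fin N → K) × (Fin N → K))} (hsup : L₁ ⊔ L₂ = ⊤)
    (hL₂ : ∀ p ∈ L₂, ∀ q ∈ L₂, polar (localPairing F N T v) p q - polar (localPairing F N T v) q p = 0)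
    (h₁ : ∀ p ∈ L₁, (g : W ≃ₗ[K] W) p = (h : W ≃ₗ[K] W) p)
    (hg : ∀ p ∈ L₂, (g : W ≃ₗ[K] W) p ∈ L₂) (hh : ∀ p ∈ L₂, (h : W ≃ₗ[K] W) p ∈ L₂) : g = h := by
  have hg2 := (mem_symplecticGroup _ _).1 g.2
  have hh2 := (mem_symplecticGroup _ _).1 h.2
  -- agreement on `L₂`
  have h₂ : ∀ p ∈ L₂, (g : W ≃ₗ[K] W) p = (h : W ≃ₗ[K] W) p := by
    intro p hp
    rw [← sub_eq_zero]
    refine (nondegenerate_alt_polar F N T v hTd).1 _ fun r => ?_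
    -- write `r = g l₁ + g l₂`
    obtain ⟨l, -, rfl⟩ : ∃ l, l ∈ (⊤ : Submodule K _) ∧ (g : W ≃ₗ[K] W) l = r :=
      ⟨(g : W ≃ₗ[K] W).symm r, Submodule.mem_top, LinearEquiv.apply_symm_apply _ _⟩
    have hl : l ∈ L₁ ⊔ L₂ := hsup ▸ Submodule.mem_top
    obtain ⟨l₁, hl₁, l₂, hl₂, rfl⟩ := Submodule.mem_sup.1 hl
    rw [alt_apply, map_add, map_sub, map_sub, map_add, map_add, LinearMap.sub_apply, LinearMap.sub_apply,
      LinearMap.add_apply, LinearMap.add_apply]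
    have e1 : polar (localPairing F N T v) ((g : W ≃ₗ[K] W) p) ((g : W ≃ₗ[K] W) l₁) -
        polar (localPairing F N T v) ((g : W ≃ₗ[K] W) l₁) ((g : W ≃ₗ[K] W) p) =
        polar (localPairing F N T v) ((h : W ≃ₗ[K] W) p) ((h : W ≃ₗ[K] W) l₁) -
          polar (localPairing F N T v) ((h : W ≃ₗ[K] W) l₁) ((h : W ≃ₗ[K] W) p) := by
      rw [hg2, hh2]
    rw [h₁ l₁ hl₁] at e1 ⊢
    have e2 := hL₂ _ (hg p hp) _ (hg l₂ hl₂)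
    have e3 := hL₂ _ (hh p hp) _ (hg l₂ hl₂)
    linear_combination e1 + e2 - e3
  refine Subtype.ext (LinearEquiv.ext fun p => ?_)
  have hp : p ∈ L₁ ⊔ L₂ := hsup ▸ Submodule.mem_top
  obtain ⟨l₁, hl₁, l₂, hl₂, rfl⟩ := Submodule.mem_sup.1 hp
  rw [map_add, map_add, h₁ l₁ hl₁, h₂ l₂ hl₂]

/-- `ℓ_w̄` (indeed any `splitLagrangian`) is isotropic for `alt (polar β_{𝕋_v})` — restated from
`splitLagrangian_isotropic`. [cite: MoeglinVignerasWaldspurger1987, Chap. 2 III.1] -/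
theorem splitLagrangian_isotropic' (hT : T.IsSymm) (w : PlacesOver E v) (hw : c • w.1 ≠ w.1) :
    ∀ p ∈ splitLagrangian F E c N hcδ hδ hd v w, ∀ q ∈ splitLagrangian F E c N hcδ hδ hd v w,
      polar (localPairing F N T v) p q - polar (localPairing F N T v) q p = 0 := by
  intro p hp q hq
  have := splitLagrangian_isotropic F E c N hcδ hδ hd v hT w hw p q hp hq
  rwa [alt_apply] at this

end Rigidity

/-! ## §6 `ι_v(κ) = γ_w⁻¹ m(a) γ_w` for `κ ∈ U(J)(F_v)` with `w`-component `a ∈ GL_N(F_v) ⊆ GL_N(E_w)` -/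

section Conj

omit [Algebra.IsQuadraticExtension F E] in
/-- entries of the `E ⊗ F_v`-matrix of `κ ∈ U(J)(F_v)`: `(κ_{ij})_{w'} = ((κ_{w'})_{ij})`. [folklore] -/
private theorem localPiEquiv_entry_apply (κ : localPi E c N J v) (i j : Fin N) (w : PlacesOver E v) :
    (((localPiEquiv E c N J v κ : «local» E c N J v) : GL (Fin N) S) : Matrix (Fin N) (Fin N) S) i j w =
      (((κ : LocalGLPi E N v) w : GL (Fin N) (w.1.adicCompletion E)) : Matrix _ _ _) i j := rfl

/-- application of a triple product in `Sp(𝕎_v)`. [folklore] -/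
private theorem coe_mul_mul_apply (g₁ g₂ g₃ : LocalSp F N T v) (p : W) :
    ((g₁ * g₂ * g₃ : LocalSp F N T v) : W ≃ₗ[K] W) p = (g₁ : W ≃ₗ[K] W) ((g₂ : W ≃ₗ[K] W) ((g₃ : W ≃ₗ[K] W) p)) :=
  rfl

include hd in
/-- on `ℓ_w`, `ι_v(κ)` acts through the `w`-component: `ι_v(κ) (x, y) = (a x, a y)` when `(κ_w) = ι_w(a)`. [folklore] -/
private theorem iota_apply_of_mem (hT : T.IsSymm) (w : PlacesOver E v) (hw : c • w.1 ≠ w.1) (κ : localPi E c N J v)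
    (a : GL (Fin N) K)
    (ha : ∀ i j, toPlace v w ((a : Matrix (Fin N) (Fin N) K) i j) =
      (((κ : LocalGLPi E N v) w : GL (Fin N) (w.1.adicCompletion E)) : Matrix _ _ _) i j)
    {p : W} (hp : p ∈ splitLagrangian F E c N hcδ hδ hd v w) :
    (iota F E c N hcδ hδ hd T hT hJ v κ : W ≃ₗ[K] W) p =
      ((a : Matrix (Fin N) (Fin N) K) *ᵥ p.1, (a : Matrix (Fin N) (Fin N) K) *ᵥ p.2) := by
  have h := isQuadraticCoordinates_local E v c hcδ hδ hd
  obtain ⟨x, hx, rfl⟩ := hp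
  have hMa : ∀ i j, splitCoord F E c hcδ hδ v w
      ((((localPiEquiv E c N J v κ : «local» E c N J v) : GL (Fin N) S) : Matrix (Fin N) (Fin N) S) i j) =
        (a : Matrix _ _ K) i j := fun i j =>
    (toPlace v w).injective (by rw [toPlace_splitCoord F E c hcδ hδ hd v w hw, ha, localPiEquiv_entry_apply])
  have hMx : ((localPiEquiv E c N J v κ).1 : GL (Fin N) S).1 *ᵥ x =
      (Matrix.GeneralLinearGroup.map (toLocalRing E v) a : GL (Fin N) S).1 *ᵥ x := by
    funext i
    simp only [Matrix.mulVec, dotProduct, Matrix.GeneralLinearGroup.map_apply]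
    refine Finset.sum_congr rfl fun j _ => ?_
    have hxj : x j = splitIdem F E v w * x j := (congrFun hx j).symm
    rw [hxj, ← mul_assoc, ← mul_assoc]
    congr 1
    rw [mul_splitIdem_eq F E c hcδ hδ hd v w hw, hMa]
  rw [iota_def]
  show (localToSymplectic E c N v hcδ hδ hd hT hJ (localPiEquiv E c N J v κ)).1 (localReIm F E c N hcδ hδ v x) = _
  rw [localToSymplectic_reIm, hMx, ← h.resAut_reIm]
  exact h.resAut_map (Fin N) a _ _

/-- on `ℓ_w`, `γ_w⁻¹ m(a) γ_w (x, y) = (a x, a y)` as well. [folklore] -/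
private theorem conj_levi_apply_of_mem (hT : T.IsSymm) (hTd' : IsUnit (localGram F N T v).det) (w : PlacesOver E v)
    (hw : c • w.1 ≠ w.1) (a : GL (Fin N) K) {p : W} (hp : p ∈ splitLagrangian F E c N hcδ hδ hd v w) :
    (((splitDarboux F E c N hcδ hδ hd T v hT w hw)⁻¹ * transportSp (localGram F N T v) hTd' (levi a) *
        splitDarboux F E c N hcδ hδ hd T v hT w hw : LocalSp F N T v) : W ≃ₗ[K] W) p =
      ((a : Matrix (Fin N) (Fin N) K) *ᵥ p.1, (a : Matrix (Fin N) (Fin N) K) *ᵥ p.2) := by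
  have hp' := (mem_splitLagrangian_iff F E c N hcδ hδ hd v w hw p).1 hp
  have h2 := two_ne_zero' F v
  have hδ' := splitSqrt_ne_zero F E c hcδ hδ hd v w hw
  rw [coe_mul_mul_apply, splitDarboux_apply_of_mem F E c N hcδ hδ hd T v hT w hw hp, transportSp_levi]
  simp only [coe_leviSp_apply, glEquiv_apply, map_zero, coe_splitDarboux_inv_apply, smul_zero, sub_zero, add_zero]
  rw [hp', mulVec_smul, mulVec_smul, smul_smul, smul_smul, ← mul_assoc, inv_mul_cancel₀ h2, one_mul,
    inv_mul_cancel₀ (mul_ne_zero h2 hδ'), one_smul]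

/-- `γ_w⁻¹ m(a) γ_w` stabilises `ℓ_w̄`. [folklore] -/
private theorem conj_levi_mem_galInv (hT : T.IsSymm) (hTd' : IsUnit (localGram F N T v).det) (w : PlacesOver E v)
    (hw : c • w.1 ≠ w.1) (a : GL (Fin N) K) {p : W}
    (hp : p ∈ splitLagrangian F E c N hcδ hδ hd v (PlacesOver.galInv c w)) :
    (((splitDarboux F E c N hcδ hδ hd T v hT w hw)⁻¹ * transportSp (localGram F N T v) hTd' (levi a) *
        splitDarboux F E c N hcδ hδ hd T v hT w hw : LocalSp F N T v) : W ≃ₗ[K] W) p ∈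
      splitLagrangian F E c N hcδ hδ hd v (PlacesOver.galInv c w) := by
  rw [coe_mul_mul_apply, splitDarboux_apply_of_mem_galInv F E c N hcδ hδ hd T v hT w hw hp, transportSp_levi]
  simp only [coe_leviSp_apply, glEquiv_apply, mulVec_zero]
  exact splitDarboux_inv_apply_inr_mem F E c N hcδ hδ hd T v hT w hw _

include hd in
/-- **`ι_v(κ) = γ_w⁻¹ m(a) γ_w`**: an element `κ ∈ U(J)(F_v)` whose `w`-component is `ι_w(a)`, `a ∈ GL_N(F_v)`
(`U(J)(F_v) ≅ GL_N(E_w)` at a split place, tree `localPiSplitEquiv`), acts on `𝕎_v` as the `γ_w`-conjugate of the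
Levi element `m(a) = (a, 𝕋_v⁻¹ a⁻ᵀ 𝕋_v)` — by rigidity: both agree on `ℓ_w` and stabilise `ℓ_w̄`.
[cite: MoeglinVignerasWaldspurger1987, Chap. 2 III.1; GelbartRogawski1991, §3.2 p. 457] -/
theorem iota_eq_conj_levi (hT : T.IsSymm) (hTd : IsUnit T.det) (hTd' : IsUnit (localGram F N T v).det)
    (w : PlacesOver E v) (hw : c • w.1 ≠ w.1) (κ : localPi E c N J v) (a : GL (Fin N) K)
    (ha : ∀ i j, toPlace v w ((a : Matrix (Fin N) (Fin N) K) i j) =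
      (((κ : LocalGLPi E N v) w : GL (Fin N) (w.1.adicCompletion E)) : Matrix _ _ _) i j) :
    iota F E c N hcδ hδ hd T hT hJ v κ =
      (splitDarboux F E c N hcδ hδ hd T v hT w hw)⁻¹ * transportSp (localGram F N T v) hTd' (levi a) *
        splitDarboux F E c N hcδ hδ hd T v hT w hw := by
  refine LocalSp.eq_of_eqOn_of_mapsTo F N T v hTd (splitLagrangian_sup_galInv F E c N hcδ hδ hd v w hw)
    (splitLagrangian_isotropic' F E c N hcδ hδ hd T v hT _ (smul_galInv_ne F E c v w hw)) ?_ ?_ ?_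
  · intro p hp
    rw [iota_apply_of_mem F E c N hcδ hδ hd T hJ v hT w hw κ a ha hp,
      conj_levi_apply_of_mem F E c N hcδ hδ hd T v hT hTd' w hw a hp]
  · intro p hp
    exact (splitLagrangian_map_iota F E c N hcδ hδ hd hJ v hT (PlacesOver.galInv c w) κ).le ⟨p, hp, rfl⟩
  · intro p hp
    exact conj_levi_mem_galInv F E c N hcδ hδ hd T v hT hTd' w hw a hp

end Conj

/-! ## §7 Valuations at a split place; the centre and the compact part as `γ_w`-conjugates of Levi elements -/

section Appl

omit [Algebra.IsQuadraticExtension F E] in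
/-- **`v_w ∘ ι_w = v_v` at a split place** (`e(w|v) = 1`, tree `ramificationIdx'_eq_one_of_smul_ne`).
[cite: CasselsFrohlichANT1967, Ch. I §5 Prop. 3] -/
theorem valued_toPlace_of_split [Algebra.IsQuadraticExtension F E] (w : PlacesOver E v) (hw : c • w.1 ≠ w.1)
    (y : K) : Valued.v (toPlace v w y) = Valued.v y := by
  have he := ramificationIdx'_eq_one_of_smul_ne (F := F) c hw
  rw [w.2] at he
  rw [valued_toPlace, he, pow_one]

include hd in
/-- `v_v(a_w(s)) = v_w(s_w)`. [cite: CasselsFrohlichANT1967, Ch. II §10] -/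
theorem valued_splitCoord (w : PlacesOver E v) (hw : c • w.1 ≠ w.1) (s : S) :
    Valued.v (splitCoord F E c hcδ hδ v w s) = Valued.v (s w) := by
  rw [← valued_toPlace_of_split F E c v w hw, toPlace_splitCoord F E c hcδ hδ hd v w hw]

include hd in
/-- **`ι_w(δ_w) = δ`**: the square root `δ_w ∈ F_v` is the image of `δ` in `E_w = F_v`.
[cite: CasselsFrohlichANT1967, Ch. II §10] -/
theorem toPlace_splitSqrt (w : PlacesOver E v) (hw : c • w.1 ≠ w.1) :
    toPlace v w (splitSqrt F E c hcδ hδ v w) = algebraMap E (w.1.adicCompletion E) δ := by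
  have := congrFun (delta_mul_splitIdem F E c hcδ hδ hd v w hw) w
  rw [Pi.mul_apply, Pi.mul_apply, splitIdem_self, mul_one, mul_one, toLocalRing_apply] at this
  rw [← this]
  rfl

include hd in
/-- `v_v(δ_w) = v_w(δ)` — so `δ_w` is a `v`-adic unit for almost all `v`. [cite: CasselsFrohlichANT1967, Ch. II §10] -/
theorem valued_splitSqrt (w : PlacesOver E v) (hw : c • w.1 ≠ w.1) :
    Valued.v (splitSqrt F E c hcδ hδ v w) = Valued.v (algebraMap E (w.1.adicCompletion E) δ) := by
  rw [← valued_toPlace_of_split F E c v w hw, toPlace_splitSqrt F E c hcδ hδ hd v w hw]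

include hd in
/-- **for almost all `v`, `δ_w` is a unit at every split `w ∣ v`**. [cite: CasselsFrohlichANT1967, Ch. II §16] -/
theorem eventually_forall_valued_splitSqrt_eq_one :
    ∀ᶠ u : HeightOneSpectrum (𝓞 F) in Filter.cofinite, ∀ w : PlacesOver E u, c • w.1 ≠ w.1 →
      Valued.v (splitSqrt F E c hcδ hδ u w) = 1 := by
  filter_upwards [eventually_forall_placesOver_valued_eq_one (F := F) δ hδ] with u hu w hw
  rw [valued_splitSqrt F E c hcδ hδ hd u w hw]
  exact hu w

omit [Algebra.IsQuadraticExtension F E] in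
/-- **`2` is a `v`-adic unit for almost all `v`**. [cite: CasselsFrohlichANT1967, Ch. II §16] -/
theorem eventually_valued_two_eq_one :
    ∀ᶠ u : HeightOneSpectrum (𝓞 F) in Filter.cofinite, Valued.v (2 : u.adicCompletion F) = 1 := by
  have h2 : ∀ᶠ u : HeightOneSpectrum (𝓞 F) in Filter.cofinite, Valued.v ((2 : F) : u.adicCompletion F) = 1 :=
    (FiniteAdeleRing.isUnit_iff.mp
      ((IsUnit.mk0 (2 : F) two_ne_zero).map (algebraMap F (FiniteAdeleRing (𝓞 F) F)))).2
  filter_upwards [h2] with u hu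
  rwa [show ((2 : F) : u.adicCompletion F) = algebraMap F (u.adicCompletion F) 2 from rfl, map_ofNat] at hu

include hd in
/-- **the centre as a conjugated scalar Levi element**: for `z₀ ∈ U(J₁)(F_v) = E_v¹` with `w`-component `ζ`,
`ι_v(z₀ · 1_N) = γ_w⁻¹ m(t · 1_N) γ_w` with `t = a_w(ζ) ∈ F_v` (`ι_w(t) = ζ_w`). At a split place the centre
`E_v¹ ≅ E_w^×` is a split torus acting on the Lagrangian `ℓ_w` by the scalar `ζ_w`.
[cite: GelbartRogawski1991, §3.2 p. 457; Mok2014, §1 Notation p. 5] -/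
theorem iota_localCenter_eq (hT : T.IsSymm) (hTd : IsUnit T.det) (hTd' : IsUnit (localGram F N T v).det)
    (w : PlacesOver E v) (hw : c • w.1 ≠ w.1) {J₁ : Matrix (Fin 1) (Fin 1) E} (hJ₁ : J₁ 0 0 ≠ 0)
    (z₀ : localPi E c 1 J₁ v) (a₀ : GL (Fin N) K)
    (ha₀ : (a₀ : Matrix (Fin N) (Fin N) K) =
      splitCoord F E c hcδ hδ v w
        (fun w' => (((z₀ : LocalGLPi E 1 v) w' : GL (Fin 1) (w'.1.adicCompletion E)) :
          Matrix (Fin 1) (Fin 1) (w'.1.adicCompletion E)) 0 0) • (1 : Matrix (Fin N) (Fin N) K)) :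
    iota F E c N hcδ hδ hd T hT hJ v (localCenter E c N J J₁ hJ₁ v z₀) =
      (splitDarboux F E c N hcδ hδ hd T v hT w hw)⁻¹ * transportSp (localGram F N T v) hTd' (levi a₀) *
        splitDarboux F E c N hcδ hδ hd T v hT w hw :=
  iota_eq_conj_levi F E c N hcδ hδ hd T hJ v hT hTd hTd' w hw _ a₀ fun i j => by
    rw [ha₀, coe_localCenter, coe_localScalarGL_apply, Matrix.smul_apply, Matrix.smul_apply, smul_eq_mul,
      smul_eq_mul, map_mul, toPlace_splitCoord F E c hcδ hδ hd v w hw]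
    by_cases hij : i = j
    · subst hij
      rw [Matrix.one_apply_eq, Matrix.one_apply_eq, map_one]
    · rw [Matrix.one_apply_ne hij, Matrix.one_apply_ne hij, map_zero]

include hd in
/-- **the `w`-factor as conjugated Levi elements**: under `U(J)(F_v) ≅ GL_N(E_w)` (tree `localPiSplitEquiv`) the
element with `w`-component `ι_w(a)`, `a ∈ GL_N(F_v)`, acts on `𝕎_v` as `γ_w⁻¹ m(a) γ_w`.
[cite: GelbartRogawski1991, §3.2 p. 457; MoeglinVignerasWaldspurger1987, Chap. 2 III.1] -/
theorem iota_localPiSplitEquiv_symm_map (hT : T.IsSymm) (hTd : IsUnit T.det) (hTd' : IsUnit (localGram F N T v).det)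
    (hc : c ≠ 1) (hJc : (J.map c)ᵀ = J) (w : PlacesOver E v) (hw : c • w.1 ≠ w.1) (hJw : IsUnit (placeForm J w.1))
    (a : GL (Fin N) K) :
    iota F E c N hcδ hδ hd T hT hJ v
        ((localPiSplitEquiv c J hc hJc w hw hJw).symm (Matrix.GeneralLinearGroup.map (toPlace v w) a)) =
      (splitDarboux F E c N hcδ hδ hd T v hT w hw)⁻¹ * transportSp (localGram F N T v) hTd' (levi a) *
        splitDarboux F E c N hcδ hδ hd T v hT w hw :=
  iota_eq_conj_levi F E c N hcδ hδ hd T hJ v hT hTd hTd' w hw _ a fun i j => by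
    rw [← localPiSplitEquiv_apply c J hc hJc w hw hJw, ContinuousMulEquiv.apply_symm_apply]
    rfl

omit [Algebra.IsQuadraticExtension F E] in
/-- `x ∈ 𝒪[L_u] ↔ v_u(x) ≤ 1` (bridge between the `ValuativeRel` integers of `glInt` and `Valued.v`). [folklore] -/
private theorem mem_integer_iff_valued_le_one {L : Type} [Field L] [NumberField L] {u : HeightOneSpectrum (𝓞 L)}
    (x : u.adicCompletion L) : x ∈ (ValuativeRel.valuation (u.adicCompletion L)).integer ↔ Valued.v x ≤ 1 := by
  rw [Valuation.mem_integer_iff, ← Valuation.vle_one_iff (ValuativeRel.valuation (u.adicCompletion L)),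
    Valuation.vle_one_iff Valued.v]

omit [Algebra.IsQuadraticExtension F E] in
/-- `ι_w(𝒪_v) ⊆ 𝒪_w`. [folklore] -/
private theorem toPlace_mem_integer (w : PlacesOver E v) {y : K}
    (hy : y ∈ (ValuativeRel.valuation K).integer) :
    toPlace v w y ∈ (ValuativeRel.valuation (w.1.adicCompletion E)).integer := by
  rw [mem_integer_iff_valued_le_one, ← HeightOneSpectrum.mem_adicCompletionIntegers] at hy ⊢
  exact toPlace_mem_adicCompletionIntegers v w hy

omit [Algebra.IsQuadraticExtension F E] in
/-- `ι_w(GL_N(𝒪_v)) ⊆ GL_N(𝒪_w)`. [cite: PlatonovRapinchuk1994, §5.1] -/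
theorem map_toPlace_mem_glInt (w : PlacesOver E v) {a : GL (Fin N) K} (ha : a ∈ glInt N K) :
    Matrix.GeneralLinearGroup.map (toPlace v w) a ∈ glInt N (w.1.adicCompletion E) := by
  rw [mem_glInt_iff] at ha ⊢
  refine ⟨fun i j => toPlace_mem_integer F E v w (ha.1 i j), fun i j => ?_⟩
  rw [← map_inv]
  exact toPlace_mem_integer F E v w (ha.2 i j)

/-- the element of `U(J)(F_v)` with `w`-component `ι_w(a)`, `a ∈ GL_N(𝒪_v)`, is integral (`J` integral and invertible
at `w`). [cite: PlatonovRapinchuk1994, §5.1] -/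
theorem localPiSplitEquiv_symm_map_mem_localInt (hc : c ≠ 1) (hJc : (J.map c)ᵀ = J) (w : PlacesOver E v)
    (hw : c • w.1 ≠ w.1) (hJw : IsUnit (placeForm J w.1)) (hJi : hJw.unit ∈ glInt N (w.1.adicCompletion E))
    {a : GL (Fin N) K} (ha : a ∈ glInt N K) :
    (localPiSplitEquiv c J hc hJc w hw hJw).symm (Matrix.GeneralLinearGroup.map (toPlace v w) a) ∈
      localInt E c N J v :=
  (localPiSplitEquiv_symm_mem_localInt_iff c J hc hJc w hw hJw hJi _).2 (map_toPlace_mem_glInt F E N v w ha)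

include hd in
/-- **the compact part as conjugated integral Levi elements** (hypothesis `hu` of `SchrodingerConjugateTorusSpherical`):
every `a ∈ GL_N(𝒪_v)` is the `w`-component of some `κ ∈ U(J)(𝒪_v)` with `ι_v(κ) = γ_w⁻¹ m(a) γ_w`.
[cite: GelbartRogawski1991, §3.2 p. 457; PlatonovRapinchuk1994, §5.1] -/
theorem exists_localInt_iota_eq (hT : T.IsSymm) (hTd : IsUnit T.det) (hTd' : IsUnit (localGram F N T v).det)
    (hc : c ≠ 1) (hJc : (J.map c)ᵀ = J) (w : PlacesOver E v) (hw : c • w.1 ≠ w.1) (hJw : IsUnit (placeForm J w.1))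
    (hJi : hJw.unit ∈ glInt N (w.1.adicCompletion E)) (a : GL (Fin N) 𝒪[K]) :
    ∃ κ ∈ localInt E c N J v, iota F E c N hcδ hδ hd T hT hJ v κ =
      (splitDarboux F E c N hcδ hδ hd T v hT w hw)⁻¹ *
        transportSp (localGram F N T v) hTd' (levi (Matrix.GeneralLinearGroup.map (𝒪[K]).subtype a)) *
        splitDarboux F E c N hcδ hδ hd T v hT w hw :=
  ⟨_, localPiSplitEquiv_symm_map_mem_localInt F E c N v hc hJc w hw hJw hJi ⟨a, rfl⟩,
    iota_localPiSplitEquiv_symm_map F E c N hcδ hδ hd T hJ v hT hTd hTd' hc hJc w hw hJw _⟩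

/-- **orientation of a generator**: if `z₀` generates `U(J₁)(F_v)` modulo `U(J₁)(𝒪_v)` at a split place (`J₁` a unit
at `w`), then its `w`-component has valuation `q_w^{∓1}` — `z₀` or `z₀⁻¹` is a uniformiser of the split torus
`E_v¹ ≅ E_w^×`. [cite: PlatonovRapinchuk1994, §5.1; GelbartRogawski1991, §3.2 p. 457] -/
theorem valued_entry_eq_exp_or_of_generates (hc : c ≠ 1) {J₁ : Matrix (Fin 1) (Fin 1) E} (hJ₁c : (J₁.map c)ᵀ = J₁)
    (w : PlacesOver E v) (hw : c • w.1 ≠ w.1) (hj : Valued.v (algebraMap E (w.1.adicCompletion E) (J₁ 0 0)) = 1)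
    (z₀ : localPi E c 1 J₁ v)
    (hz₀ : ∀ h : localPi E c 1 J₁ v,
      ∃ (k₀ : localPi E c 1 J₁ v) (m : ℤ), k₀ ∈ localInt E c 1 J₁ v ∧ h = k₀ * z₀ ^ m) :
    Valued.v ((((z₀ : LocalGLPi E 1 v) w : GL (Fin 1) (w.1.adicCompletion E)) :
        Matrix (Fin 1) (Fin 1) (w.1.adicCompletion E)) 0 0) = WithZero.exp (-1 : ℤ) ∨
      Valued.v ((((z₀ : LocalGLPi E 1 v) w : GL (Fin 1) (w.1.adicCompletion E)) :
        Matrix (Fin 1) (Fin 1) (w.1.adicCompletion E)) 0 0) = WithZero.exp (1 : ℤ) := by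
  have hj0 : algebraMap E (w.1.adicCompletion E) (J₁ 0 0) ≠ 0 := fun h0 => by
    rw [h0, map_zero] at hj; exact zero_ne_one hj
  have hJw : IsUnit (placeForm J₁ w.1) := by
    rw [Matrix.isUnit_iff_isUnit_det, Matrix.det_fin_one]
    exact isUnit_iff_ne_zero.2 hj0
  have hJi : hJw.unit ∈ glInt 1 (w.1.adicCompletion E) := unit_placeForm_mem_glInt_one J₁ hJw hj
  let e := localPiSplitEquiv c J₁ hc hJ₁c w hw hJw
  -- a uniformiser `π` of `E_w`, as an element `g₀ ∈ GL₁(E_w)`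
  obtain ⟨π, hπ⟩ := IsDedekindDomain.HeightOneSpectrum.valuation_exists_uniformizer E w.1
  have hπv : Valued.v (algebraMap E (w.1.adicCompletion E) π) = WithZero.exp (-1 : ℤ) := by
    rw [show algebraMap E (w.1.adicCompletion E) π = (π : w.1.adicCompletion E) from rfl,
      IsDedekindDomain.HeightOneSpectrum.valuedAdicCompletion_eq_valuation', hπ]
  have hπ0 : algebraMap E (w.1.adicCompletion E) π ≠ 0 := fun h0 => by
    rw [h0, map_zero] at hπv; exact WithZero.exp_ne_zero hπv.symm
  let g₀ : GL (Fin 1) (w.1.adicCompletion E) :=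
    Matrix.GeneralLinearGroup.mkOfDetNeZero !![algebraMap E (w.1.adicCompletion E) π]
      (by rw [Matrix.det_fin_one_of]; exact hπ0)
  have hg₀ : Valued.v ((Matrix.GeneralLinearGroup.det g₀ : (w.1.adicCompletion E)ˣ) : w.1.adicCompletion E) =
      WithZero.exp (-1 : ℤ) := by
    rw [Matrix.GeneralLinearGroup.val_det_apply, Matrix.GeneralLinearGroup.val_mkOfDetNeZero, Matrix.det_fin_one_of]
    exact hπv
  -- `e.symm g₀ = k₀ z₀ ^ m` with `k₀` integral: take `v_w ∘ det ∘ e`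
  obtain ⟨k₀, m, hk₀, hk⟩ := hz₀ (e.symm g₀)
  have hk₀' : Valued.v ((Matrix.GeneralLinearGroup.det (e k₀) : (w.1.adicCompletion E)ˣ) : w.1.adicCompletion E) = 1 :=
    (valued_det_eq_one_iff_mem_glInt_one (e k₀)).2 (localPiSplitEquiv_mem_glInt c J₁ hc hJ₁c w hw hJw hk₀)
  have hdet := congrArg
    (fun u : localPi E c 1 J₁ v => Valued.v ((Matrix.GeneralLinearGroup.det (e u) : (w.1.adicCompletion E)ˣ) :
      w.1.adicCompletion E)) hk
  rw [ContinuousMulEquiv.apply_symm_apply, hg₀, map_mul, map_zpow, map_mul, map_zpow, Units.val_mul,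
    Units.val_zpow_eq_zpow_val, map_mul, map_zpow₀, hk₀', one_mul] at hdet
  -- `v_w(det z₀_w) = v_w(ζ)`
  have hζ : ((Matrix.GeneralLinearGroup.det (e z₀) : (w.1.adicCompletion E)ˣ) : w.1.adicCompletion E) =
      (((z₀ : LocalGLPi E 1 v) w : GL (Fin 1) (w.1.adicCompletion E)) :
        Matrix (Fin 1) (Fin 1) (w.1.adicCompletion E)) 0 0 := by
    rw [Matrix.GeneralLinearGroup.val_det_apply, Matrix.det_fin_one]
    rfl
  rw [hζ] at hdet
  set x := Valued.v ((((z₀ : LocalGLPi E 1 v) w : GL (Fin 1) (w.1.adicCompletion E)) :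
    Matrix (Fin 1) (Fin 1) (w.1.adicCompletion E)) 0 0) with hx
  have hx0 : x ≠ 0 := by
    rw [hx, ← hζ]
    exact (Valuation.ne_zero_iff _).2 (Units.ne_zero _)
  rw [← WithZero.exp_log hx0, ← WithZero.exp_zsmul, smul_eq_mul] at hdet
  have hml : m * WithZero.log x = -1 := WithZero.exp_injective hdet.symm
  rw [← WithZero.exp_log hx0]
  rcases Int.eq_one_or_neg_one_of_mul_eq_neg_one' hml with ⟨-, h1⟩ | ⟨-, h1⟩
  · exact Or.inl (by rw [h1])
  · exact Or.inr (by rw [h1])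

end Appl






end Literature.NumberTheory.GelbartRogawski1991.UnitaryDualPair.LocalSplitting

end
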